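import Summits.CriticalPhenomena.PercolationContinuityZ3.Theorems.Transplant.SkelNegBParamsFaceCountsRangeYA
import Summits.CriticalPhenomena.PercolationContinuityZ3.Theorems.Transplant.SkelNegBParamsFaceFloorsClrYA
import Summits.CriticalPhenomena.PercolationContinuityZ3.Theorems.Transplant.SkelNegBParamsFaceFloorsZPiYA
import HarnessLib

/-!
# N1 params, M3′ — the p1 groups of the y′-face PINNED AT hp-8's COUNTS (`Nr := KS.NrY yL x du z`, `N₃ := KS.N3Y yL x z`, `σT := KS.σTY yL x z`,
# CountsYA): `hclr₃_YA`, `hπ2Y_YA`, `hπ3Y_YA` = the generic `hclr₃_YA_gen` (ClrYA p322863) / `hπ2Y_YA_gen`, `hπ3Y_YA_gen` (ZPiYA p323912) with their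
# count hypotheses (`13 ≤ Nr`, `N₃ + 2 ≤ 2000·Kq`, `Nr + 1 ≤ 1000·Kq`, `N₃ + 1 ≤ 1000·Kq`) DISCHARGED by the ranges (`clr_NrY_lb`, `NrY_range`,
# `N3Y_range`, CountsRangeYA) from a premise block of the x-face skeleton's shape with the axes exchanged: `du.1 = 1`, `faceL 1 j ∓ E`,
# `|z 0 − cen x 0| ≤ kE ≤ 5r₀`, `E ≤ u₁A`, origin readings `|F1cA yL| ≤ 6u₁A`, `|FcA yL| ≤ 6u₀A` (p1-g14, 2026-08-22; landing origin `yL`, start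
# half-widths `qB′ qB₃′` and the window radius `r` generic as in hp-8's consumer F-GLUE-CONSUMER-SHAPE §3; `hfR/hZfar` need no counts: `hfR_YA_gen/hZfar_YA_gen`).
builds on p205010 (kernel theorem, internal audit signed; external expert review pending) — nothing in this file uses p205010; NOTHING is claimed about the node
`SamePDropOfSkeletonNeg₁` (OPEN); arithmetic only.
Lane `prim-bschramm-*`, seat `prim-bschramm-p1` (gen 14); helper file (`--supports stmt-CriticalPhenomena-4575 --as helper`); slot-ledger ζ′ v1/v2.
* **`hclr₃_YA`**, **`hπ2Y_YA`**, **`hπ3Y_YA`**.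
[cite: KozmaNitzan2024, §4 Lemma 12 (pp. 23–25)] [cite: MartineauTassion2017, §4.3 Lemma 4.2]
-/

noncomputable section

open scoped Classical

namespace Summit.CriticalPhenomena.PercolationContinuityZ3.Theorems.Transplant

namespace PlanarSkeletonNeg

namespace NegB

open Literature.Probability.Percolation Literature.Probability.LatticeModels SimpleGraph
open Literature.Probability.Percolation.KozmaNitzan.Cells (oth sgOf sgOf_sign)
open SkelConc (Consts)
open Skelφ (shearUnit xBoxLoA xBoxHiA xBoxB crossOffY yPrmW)
open Skelφ.StepI (DataN)
open TwoAxis.Para (modulus)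
open Neg

namespace KS

section PinY

variable (κ : Consts) {V : Type} [DecidableEq V] [Countable V] {G : SimpleGraph V} [G.LocallyFinite] (Φ : PlanarSkeletonNeg G) (t : V)
  (p : unitInterval) (D : DataN V) (c mk g f : ℕ)

/-- **M3 y′-face field `hclr₃` at hp-8's counts** (`FloorsY2.hclr₃`, `σT := σTY`, `N₃ := N3Y`, `Nr := NrY`; `qB₃′` generic): every region of the
tangential x-run is clear of the seed box by LEVEL. [cite: KozmaNitzan2024, §4 Lemma 12 (pp. 23–25)] [cite: MartineauTassion2017, §4.3 Lemma 4.2] -/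
theorem hclr₃_YA (hN : EqNumL κ Φ t p D g f) (hκ : (hL κ Φ t p D g f).natAbs ≤ 10 * nL κ Φ t p D g f)
    (hℓA : 22000 * Neg.Kq κ * (RA' κ Φ t p D mk + 2) ≤ ℓL κ Φ t p D g f)
    (x : Site 2) (du : MDir) (hd : du.1 = 1) (j : ℕ) (hj : j < (fcellsA κ Φ t p D g f).K) (z : Site 2) {E : ℕ} {kE : ℤ}
    (hlev1 : (fcellsA κ Φ t p D g f).faceL 1 j - E ≤ (fcellsA κ Φ t p D g f).lev du x z) (hlev2 : (fcellsA κ Φ t p D g f).lev du x z ≤ (fcellsA κ Φ t p D g f).faceL 1 j + E)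
    (hz : |z 0 - (fcellsA κ Φ t p D g f).cen x 0| ≤ kE) (hEu : (E : ℤ) ≤ u₁A κ Φ t p D g f) (hkE : kE ≤ 5 * ((fcellsA κ Φ t p D g f).r 0 : ℤ))
    (yL : Site 2) (he0 : |FcA κ Φ t p D g f yL| ≤ 6 * u₀A κ Φ t p D g f) (he1 : |F1cA κ Φ t p D g f yL| ≤ 6 * u₁A κ Φ t p D g f) (qB₃ : ℕ) :
    ∀ k ≤ N3Y κ Φ t p D g f yL x z,
      (∀ b : ℤ, min (σTY κ Φ t p D g f yL x z * xBoxLoA (nL κ Φ t p D g f) qB₃ (RA' κ Φ t p D mk) k) (σTY κ Φ t p D g f yL x z * xBoxHiA (nL κ Φ t p D g f) qB₃ (RA' κ Φ t p D mk) k) ≤ b →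
        b ≤ max (σTY κ Φ t p D g f yL x z * xBoxLoA (nL κ Φ t p D g f) qB₃ (RA' κ Φ t p D mk) k) (σTY κ Φ t p D g f yL x z * xBoxHiA (nL κ Φ t p D g f) qB₃ (RA' κ Φ t p D mk) k) →
        ((Mu D : ℕ) : ℤ) < |b + (yL + crossOffY (nL κ Φ t p D g f) (ℓL κ Φ t p D g f) (hL κ Φ t p D g f) (vL κ Φ t p D g f) (sgOf du) (NrY κ Φ t p D g f yL x du z)) 0|) ∨
      ((shearUnit (nL κ Φ t p D g f) (hL κ Φ t p D g f) : ℤ) * (Mu D) +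
          (shearUnit (nL κ Φ t p D g f) (hL κ Φ t p D g f) : ℤ) * (xBoxB (nL κ Φ t p D g f) (ℓL κ Φ t p D g f) (hL κ Φ t p D g f) (RA' κ Φ t p D mk) k + 1) ≤
        |(nL κ Φ t p D g f : ℤ) * (yL + crossOffY (nL κ Φ t p D g f) (ℓL κ Φ t p D g f) (hL κ Φ t p D g f) (vL κ Φ t p D g f) (sgOf du) (NrY κ Φ t p D g f yL x du z)) 1 -
          hL κ Φ t p D g f * (yL + crossOffY (nL κ Φ t p D g f) (ℓL κ Φ t p D g f) (hL κ Φ t p D g f) (vL κ Φ t p D g f) (sgOf du) (NrY κ Φ t p D g f yL x du z)) 0|) := by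
  have hu0 : 1 ≤ u₀A κ Φ t p D g f := (units_eqA κ Φ t p D g f).2.2.2.2.2.2.1
  have hu1 : 1 ≤ u₁A κ Φ t p D g f := (units_eqA κ Φ t p D g f).2.2.2.2.2.2.2
  have hNr := clr_NrY_lb κ Φ t p D g f x du hd z hj hlev1 hlev2 yL he1 (by linarith)
  have hN3 := N3Y_range κ Φ t p D g f yL x z hz hkE he0 (by linarith)
  have hNr' : 13 ≤ NrY κ Φ t p D g f yL x du z := by
    have hq : (1 : ℤ) ≤ (Neg.Kq κ : ℤ) := by exact_mod_cast Neg.one_le_Kq κ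
    have : (13 : ℤ) ≤ (NrY κ Φ t p D g f yL x du z : ℤ) := by linarith
    exact_mod_cast this
  have hN3' : N3Y κ Φ t p D g f yL x z + 2 ≤ 2000 * Neg.Kq κ := by have := Neg.one_le_Kq κ; omega
  exact hclr₃_YA_gen κ Φ t p D mk g f hN hκ hℓA du yL (by linarith) hNr' hN3' (σTY κ Φ t p D g f yL x z) qB₃

/-- **M3 y′-face field `hπ2Y` at hp-8's counts** (`Nr := NrY`; `qB′`, `r` generic with the ONE r-floor `hr`). [cite: KozmaNitzan2024, §4 Lemma 12 (pp. 23–25)] -/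
theorem hπ2Y_YA (hN : EqNumL κ Φ t p D g f) (hκ : (hL κ Φ t p D g f).natAbs ≤ 10 * nL κ Φ t p D g f)
    (hnA : 2000 * Neg.Kq κ * (RA' κ Φ t p D mk + 2) ≤ nL κ Φ t p D g f) (hℓA : 22000 * Neg.Kq κ * (RA' κ Φ t p D mk + 2) ≤ ℓL κ Φ t p D g f)
    (hSF : 16 * SF κ Φ t p D c mk ≤ ML κ Φ t p D g)
    (x : Site 2) (du : MDir) (hd : du.1 = 1) (j : ℕ) (hj : j < (fcellsA κ Φ t p D g f).K) (z : Site 2) {E : ℕ}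
    (hlev1 : (fcellsA κ Φ t p D g f).faceL 1 j - E ≤ (fcellsA κ Φ t p D g f).lev du x z) (hlev2 : (fcellsA κ Φ t p D g f).lev du x z ≤ (fcellsA κ Φ t p D g f).faceL 1 j + E)
    (hEu : (E : ℤ) ≤ u₁A κ Φ t p D g f) (yL : Site 2) (he1 : |F1cA κ Φ t p D g f yL| ≤ 6 * u₁A κ Φ t p D g f)
    (hyl : (yL 0).natAbs + (yL 1).natAbs ≤ YbF κ Φ t p D c mk g f) (qB : ℕ) (r : ℕ) (hr : ∀ X : ℕ, X + 1 ≤ exA κ Φ t p D g f → X ≤ r) :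
    ∀ k ≤ NrY κ Φ t p D g f yL x du z, ((yL 0).natAbs + (yL 1).natAbs) + (((((k + 1 : ℕ) : ℤ) * vL κ Φ t p D g f).natAbs +
      (((shearUnit (nL κ Φ t p D g f) (hL κ Φ t p D g f) : ℤ) * |((k + 1 : ℕ) : ℤ) * (yPrmW (nL κ Φ t p D g f) (ℓL κ Φ t p D g f) (hL κ Φ t p D g f) (vL κ Φ t p D g f) (RA' κ Φ t p D mk) qB (NrY κ Φ t p D g f yL x du z)).sLo| +
        |hL κ Φ t p D g f| * |((k + 1 : ℕ) : ℤ) * vL κ Φ t p D g f| + shearUnit (nL κ Φ t p D g f) (hL κ Φ t p D g f)) / nL κ Φ t p D g f).natAbs + 1)) ≤ r := by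
  have hu1 : 1 ≤ u₁A κ Φ t p D g f := (units_eqA κ Φ t p D g f).2.2.2.2.2.2.2
  obtain ⟨-, hNr⟩ := NrY_range κ Φ t p D g f x du hd z hj hlev1 hlev2 yL he1 (by linarith)
  have hNr' : NrY κ Φ t p D g f yL x du z + 1 ≤ 1000 * Neg.Kq κ := by omega
  exact hπ2Y_YA_gen κ Φ t p D c mk g f hN hκ hnA hℓA hSF yL hyl hNr' qB r hr

/-- **M3 y′-face field `hπ3Y` at hp-8's counts** (`Nr := NrY`, `N₃ := N3Y`; `r` generic with `hr`). [cite: KozmaNitzan2024, §4 Lemma 12 (pp. 23–25)] -/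
theorem hπ3Y_YA (hN : EqNumL κ Φ t p D g f) (hκ : (hL κ Φ t p D g f).natAbs ≤ 10 * nL κ Φ t p D g f)
    (hnA : 2000 * Neg.Kq κ * (RA' κ Φ t p D mk + 2) ≤ nL κ Φ t p D g f) (hℓA : 22000 * Neg.Kq κ * (RA' κ Φ t p D mk + 2) ≤ ℓL κ Φ t p D g f)
    (hSF : 16 * SF κ Φ t p D c mk ≤ ML κ Φ t p D g)
    (x : Site 2) (du : MDir) (hd : du.1 = 1) (j : ℕ) (hj : j < (fcellsA κ Φ t p D g f).K) (z : Site 2) {E : ℕ} {kE : ℤ}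
    (hlev1 : (fcellsA κ Φ t p D g f).faceL 1 j - E ≤ (fcellsA κ Φ t p D g f).lev du x z) (hlev2 : (fcellsA κ Φ t p D g f).lev du x z ≤ (fcellsA κ Φ t p D g f).faceL 1 j + E)
    (hz : |z 0 - (fcellsA κ Φ t p D g f).cen x 0| ≤ kE) (hEu : (E : ℤ) ≤ u₁A κ Φ t p D g f) (hkE : kE ≤ 5 * ((fcellsA κ Φ t p D g f).r 0 : ℤ))
    (yL : Site 2) (he0 : |FcA κ Φ t p D g f yL| ≤ 6 * u₀A κ Φ t p D g f) (he1 : |F1cA κ Φ t p D g f yL| ≤ 6 * u₁A κ Φ t p D g f)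
    (hyl : (yL 0).natAbs + (yL 1).natAbs ≤ YbF κ Φ t p D c mk g f) (r : ℕ) (hr : ∀ X : ℕ, X + 1 ≤ exA κ Φ t p D g f → X ≤ r) :
    (((yL + crossOffY (nL κ Φ t p D g f) (ℓL κ Φ t p D g f) (hL κ Φ t p D g f) (vL κ Φ t p D g f) (sgOf du) (NrY κ Φ t p D g f yL x du z)) 0).natAbs +
        ((yL + crossOffY (nL κ Φ t p D g f) (ℓL κ Φ t p D g f) (hL κ Φ t p D g f) (vL κ Φ t p D g f) (sgOf du) (NrY κ Φ t p D g f yL x du z)) 1).natAbs) +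
      (N3Y κ Φ t p D g f yL x z + 1) * shearUnit (nL κ Φ t p D g f) (hL κ Φ t p D g f) ≤ r := by
  have hu0 : 1 ≤ u₀A κ Φ t p D g f := (units_eqA κ Φ t p D g f).2.2.2.2.2.2.1
  have hu1 : 1 ≤ u₁A κ Φ t p D g f := (units_eqA κ Φ t p D g f).2.2.2.2.2.2.2
  obtain ⟨-, hNr⟩ := NrY_range κ Φ t p D g f x du hd z hj hlev1 hlev2 yL he1 (by linarith)
  have hN3 := N3Y_range κ Φ t p D g f yL x z hz hkE he0 (by linarith)
  obtain ⟨-, hNr', hN3'⟩ := capY_of_ranges κ hNr hN3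
  exact hπ3Y_YA_gen κ Φ t p D c mk g f hN hκ hnA hℓA hSF du yL hyl hNr' hN3' r hr

end PinY

end KS

end NegB

end PlanarSkeletonNeg

end Summit.CriticalPhenomena.PercolationContinuityZ3.Theorems.Transplant

end
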